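import Mathlib
import Summits.ValiantsHypothesis.ValiantsHypothesis.Theorems.KPlusLogSqLawWeakLiftingTowerGraftSignedCrossingPencil

/-!
# Tower graft line — SIGNED CROSSINGS V: spectral flow = signed crossing count (both directions), and the BALANCE LAW for grafts

Structure file for LINE (B) `Cruxes/WeakLifting/Lines/tower_graft.lean` (crux `WeakLifting` = stmt-ValiantsHypothesis-19561),
fifth of the SIGNED-CROSSING series.  Files III–IV count roots whose kernel eigenvalues all cross UPWARD (or, through `A ↦ −A`, all
downward).  Here every root may have its own direction: `U` (a finite set) marks the upward roots, the others are downward;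
`ν₋ / ν₀ / ν₊` as in file III (Mathlib's `(hH u).eigenvalues`, inline).

§1 local laws, continued: `eventually_nonnegCount_le_posCount_right` / `eventually_det_ne_zero_right` (an upward-transversal root is isolated
   from the right as well), `zeroCount_neg` (`ν₀(−A) = ν₀(A)`), ★ `eventually_negCount_eq_left_of_down` / `eventually_negCount_eq_right_of_down`
   (at a DOWNWARD-transversal point `t`, `vᵀ(H′ t)v < 0` on `ker H(t) ∖ 0`: `ν₋(u) = ν₋(t)` just left of `t` and `ν₋(u) = ν₋(t) + ν₀(t)` just
   right of `t` — through the upward laws for `−H`).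
§2 `negCount_step_signed` (across a root-free `(c, d)`: `ν₋(c) + [c ∉ U]·ν₀(c) = ν₋(d) + [d ∈ U]·ν₀(d)`), `negCount_single_crossing`, and
   ★★ `sum_up_add_negCount_eq_sum_down_add_negCount` — **SPECTRAL FLOW = SIGNED CROSSING COUNT**: entries differentiable on `[a, b]`, `det H a ≠ 0`,
   `det H b ≠ 0`, every root in `[a, b]` upward-transversal if it lies in `U` and downward-transversal otherwise; then for every finite
   `T ⊆ (a, b)` containing the roots:  `Σ_{t ∈ T ∩ U} ν₀(t) + ν₋(b) = Σ_{t ∈ T ∖ U} ν₀(t) + ν₋(a)`.  Corollaries `sum_up_le` / `sum_down_le`: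
   either kind of root mass exceeds the other by at most `|ι|`.
§3 ★★ THE BALANCE LAW FOR ONE-LETTER GRAFTS (`graft_balance`): `G = Σ_l u^{d_l}S_l` (`d_l ≤ D`), ANY symmetric far letter `S`, `0 < a < b` non-roots
   of the graft `F = G + u^D S`; if at every root `t ∈ [a, b]` the CO-EULER BASE form `vᵀ(Σ_l (D − d_l)t^{d_l}S_l)v` has one strict sign on the kernel
   of `F(t)` — negative for the roots listed in `U`, positive for the others — then `Σ_{U-roots} ν₀ + ν₋(F b) = Σ_{other roots} ν₀ + ν₋(F a)`:
   in ANY zone the co-Euler-negative and the co-Euler-positive root masses of a graft BALANCE up to the inertia flux `≤ m`, for every far letter.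
READING FOR THE LINE (honest): the Descartes step for matrices does not bound the roots of a graft by `m` per zone; it says that the roots at which
the class member `(D − θ)G` is negative on the graft's kernel and those at which it is positive come in (almost) equal masses.  A class-currency
bound on EITHER kind would bound both.  No such bound is claimed.  Zero stub credit; S4/S5, TowerB, WeakLifting, Conjecture B, 18050, VP ≠ VNP
untouched.  Def-free; Mathlib + files I–IV.  Seat: prover val-sym-lift-p2 g24, `--supports stmt-ValiantsHypothesis-19561 --as helper`.
[folklore: spectral flow of a differentiable symmetric family with regular crossings equals the signed crossing count; the packaging is this work]
-/

-- `Summit.ValiantsHypothesis.ValiantsHypothesis.…` repeats a component by the D-0017 layout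
-- (single-conjunct summit), which the `dupNamespace` linter flags; the name is mandated.
set_option linter.dupNamespace false
set_option autoImplicit false

namespace Summit.ValiantsHypothesis.ValiantsHypothesis.Theorems.KPlusLogSqLaw.TowerGraft

open Matrix Finset Filter Polynomial
open scoped BigOperators Topology
open Summit.ValiantsHypothesis.ValiantsHypothesis.Theorems.KPlusLogSqLaw (MonotoneInertia.dotProduct_sum_smul_mulVec)
open Literature.Algebra.Polynomial.MiddleMatrixSignature (card_eigenvalues_neg_add_zero_add_pos)

namespace SignedCrossing

variable {ι : Type} [Fintype ι] [DecidableEq ι]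

/-! ## §1 Local laws, continued: right isolation, and the downward jumps -/

section Local

/-- at an upward-transversal point, `#{0 ≤ λ_i(H t)} ≤ #{0 < λ_i(H u)}` for `u > t` near `t` (the transversal jump for `−H`). [folklore] -/
theorem eventually_nonnegCount_le_posCount_right (H : ℝ → Matrix ι ι ℝ) (hH : ∀ u, (H u).IsHermitian) (t : ℝ) (H' : ℝ → Matrix ι ι ℝ)
    (hd : ∀ i j, HasDerivAt (fun u => H u i j) (H' t i j) t)
    (htr : ∀ v : ι → ℝ, H t *ᵥ v = 0 → v ≠ 0 → 0 < v ⬝ᵥ H' t *ᵥ v) :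
    ∀ᶠ u in 𝓝[>] t, (univ.filter fun i => 0 ≤ (hH t).eigenvalues i).card ≤ (univ.filter fun i => 0 < (hH u).eigenvalues i).card := by
  have htr' : ∀ v : ι → ℝ, (-H t) *ᵥ v = 0 → v ≠ 0 → 0 < v ⬝ᵥ H' t *ᵥ v := fun v hv hv0 => by
    rw [Matrix.neg_mulVec, neg_eq_zero] at hv
    exact htr v hv hv0
  obtain ⟨μ, s₀, hμ, hs₀, hjump⟩ := exists_nonposCount_le_of_near_transversal (hH t).neg (H' t) htr'
  have hrem := eventually_sum_abs_remainder_le H t H' hd (half_pos hμ)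
  have hwin : ∀ᶠ u in 𝓝[>] t, t < u ∧ u < t + s₀ := Ioo_mem_nhdsGT (by linarith)
  refine ((hrem.filter_mono nhdsWithin_le_nhds).and hwin).mono fun u ⟨hru, hu1, hu2⟩ => ?_
  have h1 := hjump (u - t) (by linarith) (by linarith) (-H u) (hH u).neg ?_
  · rwa [(negCount_neg_eq_posCount (hH t) (hH t).neg).2, (negCount_neg_eq_posCount (hH u) (hH u).neg).1] at h1
  · have he : -H u - (-H t - (u - t) • H' t) = -(H u - (H t + (u - t) • H' t)) := by abel
    have hsz : (∑ i, ∑ j, |(-H u - (-H t - (u - t) • H' t)) i j|) = ∑ i, ∑ j, |(H u - (H t + (u - t) • H' t)) i j| := by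
      rw [he]
      exact Finset.sum_congr rfl fun i _ => Finset.sum_congr rfl fun j _ => by rw [Matrix.neg_apply, abs_neg]
    rw [hsz]
    have habs : |u - t| = u - t := abs_of_pos (by linarith)
    rw [habs] at hru
    have : μ / 2 * (u - t) < μ * (u - t) := by nlinarith
    linarith

/-- **an upward-transversal root is isolated from the right.** [folklore] -/
theorem eventually_det_ne_zero_right (H : ℝ → Matrix ι ι ℝ) (hH : ∀ u, (H u).IsHermitian) (t : ℝ) (H' : ℝ → Matrix ι ι ℝ)
    (hd : ∀ i j, HasDerivAt (fun u => H u i j) (H' t i j) t)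
    (htr : ∀ v : ι → ℝ, H t *ᵥ v = 0 → v ≠ 0 → 0 < v ⬝ᵥ H' t *ᵥ v) :
    ∀ᶠ u in 𝓝[>] t, (H u).det ≠ 0 := by
  have hcont : ∀ i j, ContinuousAt (fun u => H u i j) t := fun i j => (hd i j).continuousAt
  have h1 := eventually_nonnegCount_le_posCount_right H hH t H' hd htr
  have h2 := (eventually_negCount_le H hH t hcont).filter_mono (nhdsWithin_le_nhds (s := Set.Ioi t))
  refine (h1.and h2).mono fun u ⟨hu1, hu2⟩ => ?_
  rw [← zeroCount_eq_zero_iff_det_ne_zero (hH u)]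
  rw [card_nonneg_eq (hH t)] at hu1
  have := card_eigenvalues_neg_add_zero_add_pos (hH t)
  have := card_eigenvalues_neg_add_zero_add_pos (hH u)
  omega

/-- `ν₀(−A) = ν₀(A)`. [folklore] -/
theorem zeroCount_neg {A : Matrix ι ι ℝ} (hA : A.IsHermitian) (hA' : (-A).IsHermitian) :
    (univ.filter fun i => hA'.eigenvalues i = 0).card = (univ.filter fun i => hA.eigenvalues i = 0).card := by
  classical
  rw [Literature.Analysis.Matrix.EigenvalueCountOnSubspaces.card_filter_eigenvalues_neg hA hA' (fun x => x = 0)]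
  congr 1
  ext i
  simp

/-- **downward jump, left side**: at a point `t` with `vᵀ(H′ t)v < 0` for every kernel vector `v ≠ 0` of `H t` (vacuous off the roots),
`ν₋(u) = ν₋(t)` for `u < t` near `t` (the kernel eigenvalues arrive from above). [folklore; packaging this work] -/
theorem eventually_negCount_eq_left_of_down (H : ℝ → Matrix ι ι ℝ) (hH : ∀ u, (H u).IsHermitian) (t : ℝ) (H' : ℝ → Matrix ι ι ℝ)
    (hd : ∀ i j, HasDerivAt (fun u => H u i j) (H' t i j) t)
    (htr : ∀ v : ι → ℝ, H t *ᵥ v = 0 → v ≠ 0 → v ⬝ᵥ H' t *ᵥ v < 0) :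
    ∀ᶠ u in 𝓝[<] t, (univ.filter fun i => (hH u).eigenvalues i < 0).card = (univ.filter fun i => (hH t).eigenvalues i < 0).card := by
  -- the upward laws for `-H`, whose derivative `-H'` is positive on the kernel
  have hH' : ∀ u, (-H u).IsHermitian := fun u => (hH u).neg
  have hd' : ∀ i j, HasDerivAt (fun u => (-H u) i j) ((fun u => -H' u) t i j) t := fun i j => (hd i j).neg
  have htr' : ∀ v : ι → ℝ, (-H t) *ᵥ v = 0 → v ≠ 0 → 0 < v ⬝ᵥ (-H' t) *ᵥ v := fun v hv hv0 => by
    rw [Matrix.neg_mulVec, neg_eq_zero] at hv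
    rw [Matrix.neg_mulVec, dotProduct_neg]
    exact neg_pos.mpr (htr v hv hv0)
  have h1 := eventually_negCount_eq_left (fun u => -H u) hH' t (fun u => -H' u) hd' htr'
  have h2 := eventually_det_ne_zero_left (fun u => -H u) hH' t (fun u => -H' u) hd' htr'
  refine (h1.and h2).mono fun u ⟨hu1, hu2⟩ => ?_
  have hdet : (H u).det ≠ 0 := by
    intro h0
    apply hu2
    show (-H u).det = 0
    rw [Matrix.det_neg, h0, mul_zero]
  have h0u := (zeroCount_eq_zero_iff_det_ne_zero (hH u)).mpr hdet
  rw [(negCount_neg_eq_posCount (hH u) (hH' u)).1, (negCount_neg_eq_posCount (hH t) (hH' t)).1, zeroCount_neg (hH t) (hH' t)] at hu1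
  have := card_eigenvalues_neg_add_zero_add_pos (hH t)
  have := card_eigenvalues_neg_add_zero_add_pos (hH u)
  omega

/-- **downward jump, right side**: under the same hypotheses `ν₋(u) = ν₋(t) + ν₀(t)` for `u > t` near `t` (the kernel eigenvalues have
become negative). [folklore; packaging this work] -/
theorem eventually_negCount_eq_right_of_down (H : ℝ → Matrix ι ι ℝ) (hH : ∀ u, (H u).IsHermitian) (t : ℝ) (H' : ℝ → Matrix ι ι ℝ)
    (hd : ∀ i j, HasDerivAt (fun u => H u i j) (H' t i j) t)
    (htr : ∀ v : ι → ℝ, H t *ᵥ v = 0 → v ≠ 0 → v ⬝ᵥ H' t *ᵥ v < 0) :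
    ∀ᶠ u in 𝓝[>] t, (univ.filter fun i => (hH u).eigenvalues i < 0).card =
      (univ.filter fun i => (hH t).eigenvalues i < 0).card + (univ.filter fun i => (hH t).eigenvalues i = 0).card := by
  have hH' : ∀ u, (-H u).IsHermitian := fun u => (hH u).neg
  have hd' : ∀ i j, HasDerivAt (fun u => (-H u) i j) ((fun u => -H' u) t i j) t := fun i j => (hd i j).neg
  have htr' : ∀ v : ι → ℝ, (-H t) *ᵥ v = 0 → v ≠ 0 → 0 < v ⬝ᵥ (-H' t) *ᵥ v := fun v hv hv0 => by
    rw [Matrix.neg_mulVec, neg_eq_zero] at hv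
    rw [Matrix.neg_mulVec, dotProduct_neg]
    exact neg_pos.mpr (htr v hv hv0)
  have h1 := eventually_negCount_eq_right (fun u => -H u) hH' t (fun u => -H' u) hd' htr'
  have h2 := eventually_det_ne_zero_right (fun u => -H u) hH' t (fun u => -H' u) hd' htr'
  refine (h1.and h2).mono fun u ⟨hu1, hu2⟩ => ?_
  have hdet : (H u).det ≠ 0 := by
    intro h0
    apply hu2
    show (-H u).det = 0
    rw [Matrix.det_neg, h0, mul_zero]
  have h0u := (zeroCount_eq_zero_iff_det_ne_zero (hH u)).mpr hdet
  rw [(negCount_neg_eq_posCount (hH u) (hH' u)).1, (negCount_neg_eq_posCount (hH t) (hH' t)).1] at hu1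
  have := card_eigenvalues_neg_add_zero_add_pos (hH t)
  have := card_eigenvalues_neg_add_zero_add_pos (hH u)
  omega

end Local

/-! ## §2 Spectral flow = signed crossing count -/

section Flow

/-- **the signed step**: `a ≤ c < d ≤ b`, `(c, d)` root-free, every point of `[a, b]` upward-transversal if in `U` and downward-transversal
otherwise (both vacuous off the roots): `ν₋(c) + [c ∉ U]·ν₀(c) = ν₋(d) + [d ∈ U]·ν₀(d)`. [this work] -/
theorem negCount_step_signed (H H' : ℝ → Matrix ι ι ℝ) (hH : ∀ u, (H u).IsHermitian) {a b : ℝ}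
    (hd : ∀ u, a ≤ u → u ≤ b → ∀ i j, HasDerivAt (fun x => H x i j) (H' u i j) u) (U : Finset ℝ)
    (hup : ∀ u, a ≤ u → u ≤ b → u ∈ U → ∀ v : ι → ℝ, H u *ᵥ v = 0 → v ≠ 0 → 0 < v ⬝ᵥ H' u *ᵥ v)
    (hdown : ∀ u, a ≤ u → u ≤ b → u ∉ U → ∀ v : ι → ℝ, H u *ᵥ v = 0 → v ≠ 0 → v ⬝ᵥ H' u *ᵥ v < 0)
    {c d : ℝ} (hac : a ≤ c) (hcd : c < d) (hdb : d ≤ b) (hfree : ∀ u, c < u → u < d → (H u).det ≠ 0) :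
    (univ.filter fun i => (hH c).eigenvalues i < 0).card + (if c ∈ U then 0 else (univ.filter fun i => (hH c).eigenvalues i = 0).card) =
      (univ.filter fun i => (hH d).eigenvalues i < 0).card + (if d ∈ U then (univ.filter fun i => (hH d).eigenvalues i = 0).card else 0) := by
  have hcb : c ≤ b := hcd.le.trans hdb
  have had : a ≤ d := hac.trans hcd.le
  have hR : ∀ᶠ u in 𝓝[>] c, (univ.filter fun i => (hH u).eigenvalues i < 0).card =
      (univ.filter fun i => (hH c).eigenvalues i < 0).card +
        (if c ∈ U then 0 else (univ.filter fun i => (hH c).eigenvalues i = 0).card) := by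
    by_cases hc : c ∈ U
    · rw [if_pos hc, add_zero]
      exact eventually_negCount_eq_right H hH c H' (hd c hac hcb) (hup c hac hcb hc)
    · rw [if_neg hc]
      exact eventually_negCount_eq_right_of_down H hH c H' (hd c hac hcb) (hdown c hac hcb hc)
  have hL : ∀ᶠ u in 𝓝[<] d, (univ.filter fun i => (hH u).eigenvalues i < 0).card =
      (univ.filter fun i => (hH d).eigenvalues i < 0).card +
        (if d ∈ U then (univ.filter fun i => (hH d).eigenvalues i = 0).card else 0) := by
    by_cases hdU : d ∈ U
    · rw [if_pos hdU]
      exact eventually_negCount_eq_left H hH d H' (hd d had hdb) (hup d had hdb hdU)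
    · rw [if_neg hdU, add_zero]
      exact eventually_negCount_eq_left_of_down H hH d H' (hd d had hdb) (hdown d had hdb hdU)
  obtain ⟨R, hRc, hRsub⟩ := mem_nhdsGT_iff_exists_Ioo_subset.mp hR
  obtain ⟨L, hLd, hLsub⟩ := mem_nhdsLT_iff_exists_Ioo_subset.mp hL
  rw [Set.mem_Ioi] at hRc; rw [Set.mem_Iio] at hLd
  set u₁ : ℝ := (c + min R d) / 2 with hu₁
  have hm : c < min R d := lt_min hRc hcd
  have hm1 : min R d ≤ R := min_le_left _ _; have hm2 : min R d ≤ d := min_le_right _ _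
  have hu₁c : c < u₁ := by rw [hu₁]; linarith
  have hu₁R : u₁ < R := by rw [hu₁]; linarith
  have hu₁d : u₁ < d := by rw [hu₁]; linarith
  set u₂ : ℝ := (max L u₁ + d) / 2 with hu₂
  have hM : max L u₁ < d := max_lt hLd hu₁d
  have hM1 : L ≤ max L u₁ := le_max_left _ _; have hM2 : u₁ ≤ max L u₁ := le_max_right _ _
  have hu₂d : u₂ < d := by rw [hu₂]; linarith
  have hLu₂ : L < u₂ := by rw [hu₂]; linarith
  have hu₁u₂ : u₁ < u₂ := by rw [hu₂]; linarith
  have h1 := hRsub ⟨hu₁c, hu₁R⟩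
  have h2 := hLsub ⟨hLu₂, hu₂d⟩
  simp only [Set.mem_setOf_eq] at h1 h2
  have h12 := negCount_eq_of_forall_det_ne_zero H H' hH hd (hac.trans hu₁c.le) hu₁u₂.le (hu₂d.le.trans hdb)
    fun u hu1 hu2 => hfree u (hu₁c.trans_le hu1) (lt_of_le_of_lt hu2 hu₂d)
  rw [← h1, h12, h2]

/-- **one signed crossing between two non-roots**: `c < t₀ < d`, `(c, d)` contains no root other than `t₀`, `det H c ≠ 0 ≠ det H d`:
`ν₋(c) + [t₀ ∉ U]·ν₀(t₀) = ν₋(d) + [t₀ ∈ U]·ν₀(t₀)`. [this work] -/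
theorem negCount_single_crossing (H H' : ℝ → Matrix ι ι ℝ) (hH : ∀ u, (H u).IsHermitian) {a b : ℝ}
    (hd : ∀ u, a ≤ u → u ≤ b → ∀ i j, HasDerivAt (fun x => H x i j) (H' u i j) u) (U : Finset ℝ)
    (hup : ∀ u, a ≤ u → u ≤ b → u ∈ U → ∀ v : ι → ℝ, H u *ᵥ v = 0 → v ≠ 0 → 0 < v ⬝ᵥ H' u *ᵥ v)
    (hdown : ∀ u, a ≤ u → u ≤ b → u ∉ U → ∀ v : ι → ℝ, H u *ᵥ v = 0 → v ≠ 0 → v ⬝ᵥ H' u *ᵥ v < 0)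
    {c t₀ d : ℝ} (hac : a ≤ c) (hct : c < t₀) (htd : t₀ < d) (hdb : d ≤ b) (hc0 : (H c).det ≠ 0) (hd0 : (H d).det ≠ 0)
    (hfree : ∀ u, c < u → u < d → u ≠ t₀ → (H u).det ≠ 0) :
    (univ.filter fun i => (hH c).eigenvalues i < 0).card + (if t₀ ∈ U then 0 else (univ.filter fun i => (hH t₀).eigenvalues i = 0).card) =
      (univ.filter fun i => (hH d).eigenvalues i < 0).card +
        (if t₀ ∈ U then (univ.filter fun i => (hH t₀).eigenvalues i = 0).card else 0) := by
  have hs1 := negCount_step_signed H H' hH hd U hup hdown hac hct (htd.le.trans hdb) fun u hu1 hu2 => hfree u hu1 (hu2.trans htd) hu2.ne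
  have hs2 := negCount_step_signed H H' hH hd U hup hdown (hac.trans hct.le) htd hdb fun u hu1 hu2 => hfree u (hct.trans hu1) hu2 hu1.ne'
  have hc00 := (zeroCount_eq_zero_iff_det_ne_zero (hH c)).mpr hc0; have hd00 := (zeroCount_eq_zero_iff_det_ne_zero (hH d)).mpr hd0
  by_cases ht : t₀ ∈ U <;> by_cases hc : c ∈ U <;> by_cases hdU : d ∈ U <;> simp only [ht, hc, hdU, if_true, if_false] at hs1 hs2 ⊢ <;> omega

/-- **SPECTRAL FLOW = SIGNED CROSSING COUNT.**  `H` real symmetric with entries differentiable at every point of `[a, b]`, `det H a ≠ 0`,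
`det H b ≠ 0`; every point of `[a, b]` is upward-transversal (`vᵀ(H′ u)v > 0` on `ker H(u) ∖ 0`) if it lies in the finite set `U` and
downward-transversal (`< 0`) otherwise — both vacuous off the roots.  Then for every finite `T ⊆ (a, b)` containing all roots of `det H` in `(a, b)`:
`Σ_{t ∈ T ∩ U} ν₀(t) + ν₋(b) = Σ_{t ∈ T ∖ U} ν₀(t) + ν₋(a)`. [folklore: spectral flow; packaging this work] -/
theorem sum_up_add_negCount_eq_sum_down_add_negCount (H H' : ℝ → Matrix ι ι ℝ) (hH : ∀ u, (H u).IsHermitian) {a b : ℝ}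
    (hd : ∀ u, a ≤ u → u ≤ b → ∀ i j, HasDerivAt (fun x => H x i j) (H' u i j) u) (U : Finset ℝ)
    (hup : ∀ u, a ≤ u → u ≤ b → u ∈ U → ∀ v : ι → ℝ, H u *ᵥ v = 0 → v ≠ 0 → 0 < v ⬝ᵥ H' u *ᵥ v)
    (hdown : ∀ u, a ≤ u → u ≤ b → u ∉ U → ∀ v : ι → ℝ, H u *ᵥ v = 0 → v ≠ 0 → v ⬝ᵥ H' u *ᵥ v < 0)
    (hab : a ≤ b) (ha0 : (H a).det ≠ 0) (hb0 : (H b).det ≠ 0)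
    (T : Finset ℝ) (hT : ∀ t ∈ T, a < t ∧ t < b) (hcov : ∀ u, a < u → u < b → (H u).det = 0 → u ∈ T) :
    (∑ t ∈ T.filter (fun t => t ∈ U), (univ.filter fun i => (hH t).eigenvalues i = 0).card) +
        (univ.filter fun i => (hH b).eigenvalues i < 0).card =
      (∑ t ∈ T.filter (fun t => t ∉ U), (univ.filter fun i => (hH t).eigenvalues i = 0).card) +
        (univ.filter fun i => (hH a).eigenvalues i < 0).card := by
  classical
  suffices key : ∀ b', a ≤ b' → b' ≤ b → (H b').det ≠ 0 → (∀ t ∈ T, a < t ∧ t < b') →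
      (∀ u, a < u → u < b' → (H u).det = 0 → u ∈ T) →
      (∑ t ∈ T.filter (fun t => t ∈ U), (univ.filter fun i => (hH t).eigenvalues i = 0).card) +
          (univ.filter fun i => (hH b').eigenvalues i < 0).card =
        (∑ t ∈ T.filter (fun t => t ∉ U), (univ.filter fun i => (hH t).eigenvalues i = 0).card) +
          (univ.filter fun i => (hH a).eigenvalues i < 0).card from key b hab le_rfl hb0 hT hcov
  clear hT hcov
  induction T using Finset.induction_on_max with
  | empty =>
    intro b' hab' hb'b hb'0 _ hcov'
    simp only [Finset.filter_empty, Finset.sum_empty, zero_add]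
    refine (negCount_eq_of_forall_det_ne_zero H H' hH hd le_rfl hab' hb'b fun u hu1 hu2 h0 => ?_).symm
    rcases hu1.eq_or_lt with rfl | hlt1
    · exact ha0 h0
    rcases hu2.eq_or_lt with rfl | hlt2
    · exact hb'0 h0
    exact (Finset.notMem_empty u) (hcov' u hlt1 hlt2 h0)
  | insert t₀ S hlt ih =>
    intro b' hab' hb'b hb'0 hT' hcov'
    have ht₀ := hT' t₀ (Finset.mem_insert_self _ _)
    have ht₀S : t₀ ∉ S := fun h => lt_irrefl _ (hlt t₀ h)
    -- a non-root point `b''` between `S` (or `a`) and `t₀`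
    obtain ⟨lo, halo, hlot₀, hSlo, hlofree⟩ : ∃ lo, a ≤ lo ∧ lo < t₀ ∧ (∀ t ∈ S, t ≤ lo) ∧
        (∀ u, lo < u → u < t₀ → (H u).det ≠ 0) := by
      rcases S.eq_empty_or_nonempty with hSe | hSne
      · refine ⟨a, le_rfl, ht₀.1, fun t ht => ?_, fun u hu1 hu2 h0 => ?_⟩
        · rw [hSe] at ht
          exact absurd ht (Finset.notMem_empty t)
        · have hu := hcov' u hu1 (hu2.trans ht₀.2) h0
          rw [hSe] at hu
          rcases Finset.mem_insert.mp hu with rfl | hu'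
          · exact lt_irrefl _ hu2
          · exact Finset.notMem_empty u hu'
      · refine ⟨S.max' hSne, (hT' _ (Finset.mem_insert_of_mem (Finset.max'_mem S hSne))).1.le,
          hlt _ (Finset.max'_mem S hSne), fun t ht => Finset.le_max' S t ht, fun u hu1 hu2 h0 => ?_⟩
        have hu := hcov' u ((hT' _ (Finset.mem_insert_of_mem (Finset.max'_mem S hSne))).1.trans hu1) (hu2.trans ht₀.2) h0
        rcases Finset.mem_insert.mp hu with rfl | hu'
        · exact lt_irrefl _ hu2
        · exact not_le.mpr hu1 (Finset.le_max' S u hu')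
    set b'' : ℝ := (lo + t₀) / 2 with hb''
    have hlob'' : lo < b'' := by rw [hb'']; linarith
    have hb''t₀ : b'' < t₀ := by rw [hb'']; linarith
    have hb''0 : (H b'').det ≠ 0 := hlofree b'' hlob'' hb''t₀
    have hIH := ih b'' (halo.trans hlob''.le) (hb''t₀.le.trans (ht₀.2.le.trans hb'b)) hb''0
      (fun t ht => ⟨(hT' t (Finset.mem_insert_of_mem ht)).1, lt_of_le_of_lt (hSlo t ht) hlob''⟩)
      (fun u hu1 hu2 h0 => by
        have hu := hcov' u hu1 (hu2.trans (hb''t₀.trans ht₀.2)) h0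
        rcases Finset.mem_insert.mp hu with rfl | hu'
        · exact absurd (hu2.trans hb''t₀) (lt_irrefl _)
        · exact hu')
    -- the single crossing at `t₀` between the non-roots `b''` and `b'`
    have hX := negCount_single_crossing H H' hH hd U hup hdown (halo.trans hlob''.le) hb''t₀ ht₀.2 hb'b hb''0 hb'0
      fun u hu1 hu2 hne h0 => by
        have hu := hcov' u (lt_trans (halo.trans_lt hlob'') hu1) hu2 h0
        rcases Finset.mem_insert.mp hu with rfl | hu'
        · exact hne rfl
        · exact not_le.mpr (hlob''.trans hu1) (hSlo u hu')
    rw [Finset.filter_insert, Finset.filter_insert]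
    by_cases ht₀U : t₀ ∈ U
    · rw [if_pos ht₀U, if_neg (not_not.mpr ht₀U), Finset.sum_insert (fun h => ht₀S (Finset.mem_filter.mp h).1)]
      rw [if_pos ht₀U, if_pos ht₀U] at hX
      omega
    · rw [if_neg ht₀U, if_pos ht₀U, Finset.sum_insert (fun h => ht₀S (Finset.mem_filter.mp h).1)]
      rw [if_neg ht₀U, if_neg ht₀U] at hX
      omega

/-- corollary: the upward root mass exceeds the downward one by at most `|ι|`. [this work] -/
theorem sum_up_le (H H' : ℝ → Matrix ι ι ℝ) (hH : ∀ u, (H u).IsHermitian) {a b : ℝ}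
    (hd : ∀ u, a ≤ u → u ≤ b → ∀ i j, HasDerivAt (fun x => H x i j) (H' u i j) u) (U : Finset ℝ)
    (hup : ∀ u, a ≤ u → u ≤ b → u ∈ U → ∀ v : ι → ℝ, H u *ᵥ v = 0 → v ≠ 0 → 0 < v ⬝ᵥ H' u *ᵥ v)
    (hdown : ∀ u, a ≤ u → u ≤ b → u ∉ U → ∀ v : ι → ℝ, H u *ᵥ v = 0 → v ≠ 0 → v ⬝ᵥ H' u *ᵥ v < 0)
    (hab : a ≤ b) (ha0 : (H a).det ≠ 0) (hb0 : (H b).det ≠ 0)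
    (T : Finset ℝ) (hT : ∀ t ∈ T, a < t ∧ t < b) (hcov : ∀ u, a < u → u < b → (H u).det = 0 → u ∈ T) :
    (∑ t ∈ T.filter (fun t => t ∈ U), (univ.filter fun i => (hH t).eigenvalues i = 0).card) ≤
      (∑ t ∈ T.filter (fun t => t ∉ U), (univ.filter fun i => (hH t).eigenvalues i = 0).card) + Fintype.card ι := by
  have h := sum_up_add_negCount_eq_sum_down_add_negCount H H' hH hd U hup hdown hab ha0 hb0 T hT hcov
  have ha : (univ.filter fun i => (hH a).eigenvalues i < 0).card ≤ Fintype.card ι := (Finset.card_filter_le _ _).trans (by simp)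
  omega

/-- corollary: the downward root mass exceeds the upward one by at most `|ι|`. [this work] -/
theorem sum_down_le (H H' : ℝ → Matrix ι ι ℝ) (hH : ∀ u, (H u).IsHermitian) {a b : ℝ}
    (hd : ∀ u, a ≤ u → u ≤ b → ∀ i j, HasDerivAt (fun x => H x i j) (H' u i j) u) (U : Finset ℝ)
    (hup : ∀ u, a ≤ u → u ≤ b → u ∈ U → ∀ v : ι → ℝ, H u *ᵥ v = 0 → v ≠ 0 → 0 < v ⬝ᵥ H' u *ᵥ v)
    (hdown : ∀ u, a ≤ u → u ≤ b → u ∉ U → ∀ v : ι → ℝ, H u *ᵥ v = 0 → v ≠ 0 → v ⬝ᵥ H' u *ᵥ v < 0)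
    (hab : a ≤ b) (ha0 : (H a).det ≠ 0) (hb0 : (H b).det ≠ 0)
    (T : Finset ℝ) (hT : ∀ t ∈ T, a < t ∧ t < b) (hcov : ∀ u, a < u → u < b → (H u).det = 0 → u ∈ T) :
    (∑ t ∈ T.filter (fun t => t ∉ U), (univ.filter fun i => (hH t).eigenvalues i = 0).card) ≤
      (∑ t ∈ T.filter (fun t => t ∈ U), (univ.filter fun i => (hH t).eigenvalues i = 0).card) + Fintype.card ι := by
  have h := sum_up_add_negCount_eq_sum_down_add_negCount H H' hH hd U hup hdown hab ha0 hb0 T hT hcov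
  have hb : (univ.filter fun i => (hH b).eigenvalues i < 0).card ≤ Fintype.card ι := (Finset.card_filter_le _ _).trans (by simp)
  omega

end Flow

/-! ## §3 The balance law for one-letter grafts -/

section Graft

variable {m K : ℕ}

/-- **THE BALANCE LAW FOR ONE-LETTER GRAFTS.**  `G = Σ_l u^{d_l}S_l` (`d_l ≤ D`, symmetric letters), ANY symmetric far letter `S_far`,
`F = G + u^D S_far`, `0 < a ≤ b` with `det F(a) ≠ 0 ≠ det F(b)`.  Suppose that at every root `t ∈ [a, b]` of `det F` the CO-EULER BASE form
`vᵀ(Σ_l (D − d_l)t^{d_l}S_l)v` is NEGATIVE for all kernel vectors `v ≠ 0` of `F(t)` when `t ∈ U`, and POSITIVE for all of them when `t ∉ U`.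
Then for every finite `T ⊆ (a, b)` containing the roots of `det F` in `(a, b)`:  `Σ_{t ∈ T ∩ U} ν₀(F t) + ν₋(F b) = Σ_{t ∈ T ∖ U} ν₀(F t) + ν₋(F a)`
— the co-Euler-negative and co-Euler-positive root masses balance up to the inertia flux, for every far letter. [this work] -/
theorem graft_balance (D : ℕ) (d : Fin K → ℕ) (hdD : ∀ l, d l ≤ D) (S : Fin K → Matrix (Fin m) (Fin m) ℝ) (hS : ∀ l, (S l).IsSymm)
    (Sfar : Matrix (Fin m) (Fin m) ℝ) (hSfar : Sfar.IsSymm) {a b : ℝ} (ha : 0 < a) (hab : a ≤ b) (U : Finset ℝ)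
    (hneg : ∀ t, a ≤ t → t ≤ b → t ∈ U → ∀ v : Fin m → ℝ, ((∑ l, (t ^ d l) • S l) + (t ^ D) • Sfar) *ᵥ v = 0 → v ≠ 0 →
      v ⬝ᵥ (∑ l, (((D - d l : ℕ) : ℝ) * t ^ d l) • S l) *ᵥ v < 0)
    (hpos : ∀ t, a ≤ t → t ≤ b → t ∉ U → ∀ v : Fin m → ℝ, ((∑ l, (t ^ d l) • S l) + (t ^ D) • Sfar) *ᵥ v = 0 → v ≠ 0 →
      0 < v ⬝ᵥ (∑ l, (((D - d l : ℕ) : ℝ) * t ^ d l) • S l) *ᵥ v)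
    (ha0 : ((∑ l, (a ^ d l) • S l) + (a ^ D) • Sfar).det ≠ 0) (hb0 : ((∑ l, (b ^ d l) • S l) + (b ^ D) • Sfar).det ≠ 0)
    (T : Finset ℝ) (hT : ∀ t ∈ T, a < t ∧ t < b)
    (hcov : ∀ u, a < u → u < b → ((∑ l, (u ^ d l) • S l) + (u ^ D) • Sfar).det = 0 → u ∈ T) :
    (∑ t ∈ T.filter (fun t => t ∈ U), (univ.filter fun i => (ZoneFlux.isHermitian_graft D d S hS Sfar hSfar t).eigenvalues i = 0).card) +
        (univ.filter fun i => (ZoneFlux.isHermitian_graft D d S hS Sfar hSfar b).eigenvalues i < 0).card =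
      (∑ t ∈ T.filter (fun t => t ∉ U), (univ.filter fun i => (ZoneFlux.isHermitian_graft D d S hS Sfar hSfar t).eigenvalues i = 0).card) +
        (univ.filter fun i => (ZoneFlux.isHermitian_graft D d S hS Sfar hSfar a).eigenvalues i < 0).card := by
  classical
  let e : Fin (K + 1) → ℕ := Fin.snoc d D
  let Tm : Fin (K + 1) → Matrix (Fin m) (Fin m) ℝ := Fin.snoc S Sfar
  have hfam : ∀ u : ℝ, (∑ l, (u ^ e l) • Tm l) = (∑ l, (u ^ d l) • S l) + (u ^ D) • Sfar := fun u =>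
    (graft_eq_family D d S Sfar u).symm
  -- the graft as the family `H`, with entrywise derivative `H'`
  let H : ℝ → Matrix (Fin m) (Fin m) ℝ := fun u => (∑ l, (u ^ d l) • S l) + (u ^ D) • Sfar
  let H' : ℝ → Matrix (Fin m) (Fin m) ℝ := fun u => ∑ l, ((e l : ℝ) * u ^ (e l - 1)) • Tm l
  have hH : ∀ u, (H u).IsHermitian := fun u => ZoneFlux.isHermitian_graft D d S hS Sfar hSfar u
  have hd : ∀ u, a ≤ u → u ≤ b → ∀ i j, HasDerivAt (fun x => H x i j) (H' u i j) u := by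
    intro u _ _ i j
    have h := hasDerivAt_family e Tm u i j
    have hfun : (fun x : ℝ => (∑ l, (x ^ e l) • Tm l) i j) = fun x => H x i j := funext fun x => by rw [hfam x]
    rwa [hfun] at h
  -- the crossing form: `t · vᵀH'(t)v = -(co-Euler base form)` on the kernel
  have hcross : ∀ t, 0 < t → ∀ v : Fin m → ℝ, H t *ᵥ v = 0 →
      t * (v ⬝ᵥ H' t *ᵥ v) = -(v ⬝ᵥ (∑ l, (((D - d l : ℕ) : ℝ) * t ^ d l) • S l) *ᵥ v) := by
    intro t _ v hv
    have hv' : (∑ l, (t ^ e l) • Tm l) *ᵥ v = 0 := by rw [hfam t]; exact hv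
    rw [mul_crossingForm_eq e Tm t v, ← eulerShiftForm_eq_of_mem_ker e Tm t (D : ℝ) v hv']
    exact eulerShiftForm_snoc_eq D d hdD S Sfar t v
  have hup : ∀ u, a ≤ u → u ≤ b → u ∈ U → ∀ v : Fin m → ℝ, H u *ᵥ v = 0 → v ≠ 0 → 0 < v ⬝ᵥ H' u *ᵥ v := by
    intro u hau hub huU v hv hv0
    have hu : 0 < u := ha.trans_le hau
    have h1 := hneg u hau hub huU v hv hv0
    have h2 := hcross u hu v hv
    have h3 : 0 < u * (v ⬝ᵥ H' u *ᵥ v) := by rw [h2]; linarith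
    exact pos_of_mul_pos_right h3 hu.le
  have hdown : ∀ u, a ≤ u → u ≤ b → u ∉ U → ∀ v : Fin m → ℝ, H u *ᵥ v = 0 → v ≠ 0 → v ⬝ᵥ H' u *ᵥ v < 0 := by
    intro u hau hub huU v hv hv0
    have hu : 0 < u := ha.trans_le hau
    have h1 := hpos u hau hub huU v hv hv0
    have h2 := hcross u hu v hv
    have h3 : u * (v ⬝ᵥ H' u *ᵥ v) < 0 := by rw [h2]; linarith
    exact lt_of_not_ge fun hge => absurd h3 (not_lt.mpr (mul_nonneg hu.le hge))
  exact sum_up_add_negCount_eq_sum_down_add_negCount H H' hH hd U hup hdown hab ha0 hb0 T hT hcov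

end Graft

end SignedCrossing

end Summit.ValiantsHypothesis.ValiantsHypothesis.Theorems.KPlusLogSqLaw.TowerGraft
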